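import Summits.ResolutionOfSingularities.ResolutionOfSingularities.Theorems.PurelyInseparableDim4SwapTransportWindowGluePrime
import Summits.ResolutionOfSingularities.ResolutionOfSingularities.Theorems.PurelyInseparableDim4ResConeCInfPinningPrime
import Summits.ResolutionOfSingularities.ResolutionOfSingularities.Theorems.PurelyInseparableDim4ResConeCInfLegalityPrime
import Summits.ResolutionOfSingularities.ResolutionOfSingularities.Theorems.PurelyInseparableDim4ResConeCInfGameStepPrime
import Summits.ResolutionOfSingularities.ResolutionOfSingularities.Theorems.PurelyInseparableDim4ResConeCInfWindowToolsPrime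
import HarnessLib
import HarnessLib.Audit.Tags

/-!
# Purely inseparable four-folds — THE VIRTUAL WINDOW'S FRAME FOR EVERY PRIME `p`: the virtual translation vanishes and the C∞
# frame survives a pure slot step (cell `res-dim4-pi`, K2(p) lane, rung-1 POWER-CONE LINE «light pair of TAIL(p, p−1, 3) ∀ p»,
# window half W3; the `p = 5` instance is res-dim4-typ-1 g3's `…SwapTransportWindowFrame` p700415)

[OURS · counted 0 · cell `res-dim4-pi` · K2(p) lane (holder res-dim4-p-12 g5, rulings g5-2 (6) / g5-6) · seat res-dim4-typ-1 g5;
frame readings ∀ p by res-dim4-p-3 g5 (`…CInfLegalityPrime` p711661 F3, `…CInfGameStepPrime` p712468 `ledger_step_zero_prime`,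
`…CInfWindowToolsPrime` rows / straight readings / u-flag).]  Nothing here proves K2(p) for any `p`, any TAIL(p, p−1, 3), any
TAIL(7, d, e), `NoIsolatedTrap p p` or resolution of singularities in dimension ≥ 4 / characteristic `p` — NOT proved.  AI
kernel work, weaker than expert review.  Frame bookkeeping for OUR model; kills nothing by itself.

Fixed letters `λ μ | u f`, `d + 1 = p`, `2 ≤ d`; a FRAMED state `B`: ledger `x_λ x_μ`, order `d + 2`, `x^r ∣ F`, straight residual
`a·x_f^d`, exact pair ledger (`x_f`-degree `≤ d − 1 ⇒ x_λ² x_μ²` in `F`-exponents), dead ROW of `(u,f)`-bidegree `(eu, ef)`,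
`eu + ef = d − 2`, below jet `N` (`¬ (e u = eu ∧ e f = ef)` for `|e| < N`), FLAG `coeff (r + λ + μ + (eu+1)u + ef·f) ≠ 0`.
DICTIONARY against `5`: `6 ↦ d + 2`, `x_f⁴ ↦ x_f^d`, «`ū²`-row» `↦` ROW `(eu, ef)` (at `5`: `(2, 0)`), flag `3u ↦ (eu+1)u + ef·f`,
jet loss `N − 4 ↦ N − d`.  The ROW PARAMETER (`ef = c′ ∈ [0, d−2]`) is the line owner's GO (res-dim4-p-3 g5, bus 2026-08-29
10:50Z) on res-dim4-typ-1 g5's Q-FLAG (10:47Z): at `d ≥ 6` isolation no longer pins the u-axis flag to the row `ef = 0`.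
* §1 bookkeeping: `degree_succ_le_of_exact_prime` (`x_f`-degree `≤ d − 1 ⇒` degree `≥ d + 3`), `resForm_eq_of_readings_prime`,
  `tsch_row_of_exact_prime` (the Tschirnhaus row F3 wants, from the exact ledger), `coeff_rowFlag_step_zero_prime` (the FLAG
  coefficient `r + λ + μ + (eu+1)u + ef·f` is CARRIED by a pure slot corner step: degree `d + 3`, chart exponent `2`, no `p`-th power —
  res-dim4-p-3 g5's `cInf_coeff_uFlag_step_zero_prime` is the row `ef = 0`).
* §2 **`translation_eq_zero_of_frame_prime`** — (VT) ∀ p: a slot step in the chart of `λ` with translation `b′` off the slots whose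
  child has order `d + 2` and `e_G = 3` has `b′ = 0` (the `f`-component by W2 `ResCone.cInf_translation_contact_eq_zero_prime`,
  the `u`-component by the two-state pinning `hVTu` taken BY VALUE — discharged by W4a′
  `ResCone.cInf_translation_u_eq_zero_twoState_row_prime` in W4).
* §3 **`frame_step_zero_prime`** — the frame passes to the PURE slot child at jet `N − d` (F3 ∀ p (i)(ii), `ledger_step_zero_prime`,
  `row_step_zero_prime`, `coeff_rowFlag_step_zero_prime`).
[cite: Hauser2010, §§F–G] [cite: CossartJannsenSaito2020, Thm. 3.14, Lemma 13.2]
bears_on: LADDER-RESOLUTION:D157-DOOR2 (res-dim4-pi · K2(p) · power cones · virtual window frame ∀ p).  Supports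
stmt-ResolutionOfSingularities-16155 (helper).
-/

set_option linter.dupNamespace false -- mandated namespace of this single-conjunct summit

noncomputable section

namespace Summit.ResolutionOfSingularities.ResolutionOfSingularities.Theorems.PIDim4

namespace SwapTransport

open MvPolynomial Finset
open Literature.AlgebraicGeometry.Resolution
open Literature.AlgebraicGeometry.Resolution.CentreBlowup
open Literature.AlgebraicGeometry.Resolution.Hauser2010
open Literature.AlgebraicGeometry.Resolution.HauserPerlega2019

variable {K : Type} [Field K] [DecidableEq K]

/-! ## §1 Small readings of a framed state, every degree -/

omit [DecidableEq K] in
/-- In a state of order `d + 2` whose degree-`(d+2)` layer is the straight monomial `x^r x_f^d` and whose monomials of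
`x_f`-degree `≤ d − 1` carry `x_λ² x_μ²` (exact pair ledger), every monomial of `x_f`-degree `≤ d − 1` has degree `≥ d + 3`.
[OURS · bookkeeping] -/
theorem degree_succ_le_of_exact_prime {la mu u f : Fin 4} (hlm : la ≠ mu) (hlu : la ≠ u) (hlf : la ≠ f) (hmu : mu ≠ u)
    (hmf : mu ≠ f) (huf : u ≠ f) {d : ℕ} {B : State K} (ho : ordZero B.F = ((d + 2 : ℕ) : ℕ∞))
    (hr : B.r = Finsupp.single la 1 + Finsupp.single mu 1) (hstraight6 : ∀ e ∈ B.F.support, e.degree = d + 2 → e f = d)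
    (hled : ∀ e ∈ B.F.support, e f ≤ d - 1 → 2 ≤ e la ∧ 2 ≤ e mu) :
    ∀ e ∈ B.F.support, e f ≤ d - 1 → d + 3 ≤ e.degree := by
  have _ := hr
  intro e he hef
  have h6 : d + 2 ≤ e.degree := by
    have := Literature.Barriers.ResolutionOfSingularities.ordZero_le_of_coeff_ne_zero _ _
      (MvPolynomial.mem_support_iff.mp he)
    rw [ho] at this
    exact_mod_cast this
  by_contra hlt
  have hdeg : e.degree = d + 2 := by omega
  have := hstraight6 e he hdeg
  have _ := hled e he hef
  have _ := ResCone.degree_eq_quad hlm hlu hlf hmu hmf huf e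
  omega

omit [DecidableEq K] in
/-- The residual form from its readings, every degree: order `d + 2`, `|r| = 2`, straight degree-`d` readings ⇒ `resForm = a·x_f^d`.
[OURS · bookkeeping] -/
theorem resForm_eq_of_readings_prime {f : Fin 4} {s : State K} {d : ℕ} (ho : ordZero s.F = ((d + 2 : ℕ) : ℕ∞))
    (hrdeg : s.r.degree = 2) {a : K} (ha : coeff (s.r + Finsupp.single f d) s.F = a)
    (hstraight : ∀ m : Fin 4 →₀ ℕ, m.degree = d → m ≠ Finsupp.single f d → coeff (s.r + m) s.F = 0) :
    ResCone.resForm s = C a * X f ^ d := by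
  classical
  have hhom := ResCone.resForm_isHomogeneous ho
  rw [hrdeg, show d + 2 - 2 = d by omega] at hhom
  ext m
  rw [X_pow_eq_monomial, C_mul_monomial, mul_one, coeff_monomial]
  by_cases hm : m.degree = d
  · rw [ResCone.coeff_resForm, NarrowApolarity.coeff_initialForm_of_degree_eq ho (by rw [map_add, hrdeg, hm]; omega)]
    by_cases hmf : Finsupp.single f d = m
    · rw [if_pos hmf, ← hmf, ha]
    · rw [if_neg hmf, hstraight m hm (Ne.symm hmf)]
  · rw [if_neg (fun h => hm (by rw [← h, Finsupp.degree_single]))]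
    by_contra hne
    exact hm (by have := hhom hne; rw [ResCone.weight_one_eq_degree] at this; omega)

omit [DecidableEq K] in
/-- The Tschirnhaus row F3 ∀ p wants, from the exact pair ledger: `coeff_{r + (d−1)e_f + 2e_λ} F = 0` (`r = e_λ + e_μ`; the
monomial has `x_f`-degree `d − 1` and `x_μ`-exponent `1 < 2`). [OURS · bookkeeping] -/
theorem tsch_row_of_exact_prime {la mu f : Fin 4} (hlm : la ≠ mu) (hlf : la ≠ f) (hmf : mu ≠ f) {B : State K} {d : ℕ}
    (hr : B.r = Finsupp.single la 1 + Finsupp.single mu 1) (hled : ∀ e ∈ B.F.support, e f ≤ d - 1 → 2 ≤ e la ∧ 2 ≤ e mu) :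
    coeff (B.r + (Finsupp.single f (d - 1) + Finsupp.single la 2)) B.F = 0 := by
  by_contra hne
  have hmem := mem_support_iff.mpr hne
  have h3 : (B.r + (Finsupp.single f (d - 1) + Finsupp.single la 2) : Fin 4 →₀ ℕ) f = d - 1 := by
    rw [hr, Finsupp.add_apply, Finsupp.add_apply, Finsupp.add_apply, Finsupp.single_eq_of_ne hlf.symm,
      Finsupp.single_eq_of_ne hmf.symm, Finsupp.single_eq_same, Finsupp.single_eq_of_ne hlf.symm]
    omega
  obtain ⟨-, h2⟩ := hled _ hmem (by rw [h3])
  rw [hr, Finsupp.add_apply, Finsupp.add_apply, Finsupp.add_apply, Finsupp.single_eq_of_ne hlm.symm, Finsupp.single_eq_same,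
    Finsupp.single_eq_of_ne hmf, Finsupp.single_eq_of_ne hlm.symm] at h2
  omega

/-- **THE ROW-FLAG COEFFICIENT IS CARRIED** (`d + 1 = p`, `eu + ef = d − 2`): for the slot ledger `r = λ + μ`, `ord₀ F = d + 2` and a slot
chart `j ∈ {λ, μ}`, the coefficient of `x^r · x_λ x_μ u^{eu+1} f^{ef}` is the SAME at the pure-corner child: this exponent (degree `d + 3`,
`j`-exponent `2`) is fixed by the chart law and is no `p`-th power (`u`-exponent `eu + 1 ≤ p − 2`).  The row `ef = 0` is res-dim4-p-3
g5's `ResCone.cInf_coeff_uFlag_step_zero_prime`. [OURS] [cite: Hauser2010, §§F–G] -/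
theorem coeff_rowFlag_step_zero_prime (p : ℕ) {d : ℕ} (hdp : d + 1 = p) (hd2 : 2 ≤ d) {eu ef : ℕ} (hef : eu + ef = d - 2)
    {lam mu u f j : Fin 4} (hlm : lam ≠ mu) (hlu : lam ≠ u) (hlf : lam ≠ f) (hmu : mu ≠ u) (hmf : mu ≠ f) (huf : u ≠ f)
    (hj : j = lam ∨ j = mu) {s : State K} (hr : s.r = Finsupp.single lam 1 + Finsupp.single mu 1)
    (ho : ordZero s.F = ((d + 2 : ℕ) : ℕ∞)) :
    coeff (s.r + (Finsupp.single lam 1 + Finsupp.single mu 1 + Finsupp.single u (eu + 1) + Finsupp.single f ef))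
        (CentreBlowup.step p Finset.univ j 0 s).F =
      coeff (s.r + (Finsupp.single lam 1 + Finsupp.single mu 1 + Finsupp.single u (eu + 1) + Finsupp.single f ef)) s.F := by
  have hq : ((p : ℕ) : ℕ∞) ≤ ordAlong Finset.univ s.F := by
    rw [ordAlong_univ, ho]; exact_mod_cast (by omega : p ≤ d + 2)
  have hdeg : (s.r + (Finsupp.single lam 1 + Finsupp.single mu 1 + Finsupp.single u (eu + 1) + Finsupp.single f ef)).degree =
      d + 3 := by
    rw [hr]; simp only [map_add, Finsupp.degree_single]; omega
  have hej : ((s.r + (Finsupp.single lam 1 + Finsupp.single mu 1 + Finsupp.single u (eu + 1) + Finsupp.single f ef) :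
      Fin 4 →₀ ℕ)) j = 2 := by
    rcases hj with rfl | rfl
    · rw [hr]; simp [hlm.symm, hlu, hlf]
    · rw [hr]; simp [hlm, hmu, hmf]
  have heu : ((s.r + (Finsupp.single lam 1 + Finsupp.single mu 1 + Finsupp.single u (eu + 1) + Finsupp.single f ef) :
      Fin 4 →₀ ℕ)) u = eu + 1 := by
    rw [hr]; simp [hlu.symm, hmu.symm, huf]
  have hce : chartExponent p Finset.univ j
      (s.r + (Finsupp.single lam 1 + Finsupp.single mu 1 + Finsupp.single u (eu + 1) + Finsupp.single f ef)) =
      s.r + (Finsupp.single lam 1 + Finsupp.single mu 1 + Finsupp.single u (eu + 1) + Finsupp.single f ef) := by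
    rw [chartExponent, degIn_univ, hdeg, show d + 3 - p = 2 by omega, ← hej, Finsupp.update_self]
  have h := ResCone.coeff_step_zero_chartExponent p j s hq
    (e := s.r + (Finsupp.single lam 1 + Finsupp.single mu 1 + Finsupp.single u (eu + 1) + Finsupp.single f ef))
    (by rw [hdeg]; omega)
  rw [hce, if_neg (ResCone.not_isPthPowerExponent_of_not_dvd (i := u) (by
    rw [heu]; intro hdvd; have := Nat.le_of_dvd (by omega) hdvd; omega))] at h
  exact h

/-! ## §2 The virtual translation vanishes, every prime ((VT-f) by W2, (VT-u) two-state BY VALUE) -/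

omit [DecidableEq K] in
/-- **(VT) in a frame, every prime.**  In a state with ledger `x_λx_μ`, order `d + 2` (`d + 1 = p`), `x^r ∣ F` and residual
`a·x_f^d`, a `Step p` in the chart of `λ` with translation `b′` off the slots whose child has order `d + 2` and `e_G = 3` has
`b′ = 0`: the `f`-component by `ResCone.cInf_translation_contact_eq_zero_prime`, the `u`-component by the two-state pinning `hVTu`
(taken BY VALUE). [OURS] [cite: CossartJannsenSaito2020, Thm. 3.14] -/
theorem translation_eq_zero_of_frame_prime [DecidableEq K] (p : ℕ) [Fact p.Prime] {d : ℕ} (hdp : d + 1 = p)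
    {la mu u f : Fin 4} (hlm : la ≠ mu) (hlu : la ≠ u) (hlf : la ≠ f) (hmu : mu ≠ u) (hmf : mu ≠ f) (huf : u ≠ f)
    {B : State K} (hoB : ordZero B.F = ((d + 2 : ℕ) : ℕ∞)) (hrB : B.r = Finsupp.single la 1 + Finsupp.single mu 1)
    (hdivB : ∀ e ∈ B.F.support, B.r ≤ e) {a : K} (ha : a ≠ 0) (hformB : ResCone.resForm B = C a * X f ^ d)
    {b' : Fin 4 → K} (hb'la : b' la = 0) (hb'mu : b' mu = 0)
    (hoBp : ordZero (CentreBlowup.step p Finset.univ la b' B).F = ((d + 2 : ℕ) : ℕ∞))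
    (he3Bp : Module.finrank K (ResCone.resVertex (CentreBlowup.step p Finset.univ la b' B)) = 3)
    (hVTu : ∀ β : K, ordZero (CentreBlowup.step p Finset.univ la (Pi.single u β) B).F = ((d + 2 : ℕ) : ℕ∞) →
      Module.finrank K (ResCone.resVertex (CentreBlowup.step p Finset.univ la (Pi.single u β) B)) = 3 → β = 0) :
    b' = 0 := by
  have hin : initialForm B.F = monomial (Finsupp.single la 1 + Finsupp.single mu 1 + Finsupp.single f d) a := by
    rw [← ResCone.monomial_mul_resForm hdivB, hformB, hrB, X_pow_eq_monomial, C_mul_monomial, mul_one, monomial_mul, one_mul]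
  have hb'f : b' f = 0 :=
    ResCone.cInf_translation_contact_eq_zero_prime p hdp hlm.symm hlf.symm hmf.symm hoB ha hin hb'la hb'mu hoBp
  have hb'eq : b' = Pi.single u (b' u) := eq_single_of_letters hlm hlu hlf hmu hmf huf hb'la hb'mu hb'f
  have hb'u : b' u = 0 := by
    refine hVTu (b' u) ?_ ?_
    · rw [← hb'eq]; exact hoBp
    · rw [← hb'eq]; exact he3Bp
  rw [hb'eq, hb'u, Pi.single_zero]

/-! ## §3 The frame survives a pure slot step, every prime -/

/-- **FRAME PROPAGATION, every prime.**  The frame at jet `N` (ledger, `x^r ∣ F`, residual `a·x_f^d`, exact pair ledger, dead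
`ū^{d−2}`-row below `N`, flag `coeff (r + λ + μ + (d−1)u) ≠ 0`) passes to the PURE slot child in the chart of `λ` at jet `N − d`,
given that the child has order `d + 2` and `e_G = 3` (straightness of the child by F3 ∀ p `ResCone.cInf_legal_readings_of_corner_prime`;
the rest by `ResCone.ledger_step_zero_prime`, `ResCone.row_step_zero_prime`, `ResCone.cInf_coeff_uFlag_step_zero_prime`).  The
μ-chart case is the same statement with `λ ↔ μ`. [OURS] [cite: CossartJannsenSaito2020, Thm. 3.14, Lemma 13.2] -/
theorem frame_step_zero_prime (p : ℕ) [Fact p.Prime] [CharP K p] {d : ℕ} (hdp : d + 1 = p) (hd2 : 2 ≤ d)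
    {la mu u f : Fin 4} (hlm : la ≠ mu) (hlu : la ≠ u) (hlf : la ≠ f) (hmu : mu ≠ u) (hmf : mu ≠ f) (huf : u ≠ f)
    {B : State K} (hoB : ordZero B.F = ((d + 2 : ℕ) : ℕ∞)) (hrB : B.r = Finsupp.single la 1 + Finsupp.single mu 1)
    (hdivB : ∀ e ∈ B.F.support, B.r ≤ e) {a : K} (ha : a ≠ 0) (hformB : ResCone.resForm B = C a * X f ^ d)
    (hledB : ∀ e ∈ B.F.support, e f ≤ d - 1 → 2 ≤ e la ∧ 2 ≤ e mu) {N eu ef : ℕ} (hef : eu + ef = d - 2)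
    (hrowB : ∀ e ∈ B.F.support, e.degree < N → ¬ (e u = eu ∧ e f = ef))
    (hVB : coeff (B.r + (Finsupp.single la 1 + Finsupp.single mu 1 + Finsupp.single u (eu + 1) + Finsupp.single f ef)) B.F ≠ 0)
    (hoBp : ordZero (CentreBlowup.step p Finset.univ la 0 B).F = ((d + 2 : ℕ) : ℕ∞))
    (he3Bp : Module.finrank K (ResCone.resVertex (CentreBlowup.step p Finset.univ la 0 B)) = 3) :
    (CentreBlowup.step p Finset.univ la 0 B).r = Finsupp.single la 1 + Finsupp.single mu 1 ∧
    (∀ e ∈ (CentreBlowup.step p Finset.univ la 0 B).F.support, (CentreBlowup.step p Finset.univ la 0 B).r ≤ e) ∧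
    (∃ a' : K, a' ≠ 0 ∧ ResCone.resForm (CentreBlowup.step p Finset.univ la 0 B) = C a' * X f ^ d) ∧
    (∀ e ∈ (CentreBlowup.step p Finset.univ la 0 B).F.support, e f ≤ d - 1 → 2 ≤ e la ∧ 2 ≤ e mu) ∧
    (∀ e ∈ (CentreBlowup.step p Finset.univ la 0 B).F.support, e.degree < N - d → ¬ (e u = eu ∧ e f = ef)) ∧
    coeff ((CentreBlowup.step p Finset.univ la 0 B).r + (Finsupp.single la 1 + Finsupp.single mu 1 + Finsupp.single u (eu + 1) + Finsupp.single f ef))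
      (CentreBlowup.step p Finset.univ la 0 B).F ≠ 0 := by
  have hp : p.Prime := Fact.out
  have hoB' : ordZero B.F = ((p + 1 : ℕ) : ℕ∞) := by rw [hoB, show d + 2 = p + 1 by omega]
  -- ledger and divisibility
  have hrBp : (CentreBlowup.step p Finset.univ la 0 B).r = Finsupp.single la 1 + Finsupp.single mu 1 :=
    step_r_pair_of_slot p hlm hlu hlf hmu hmf huf hrB hoB' rfl
  have hdivBp : ∀ e ∈ (CentreBlowup.step p Finset.univ la 0 B).F.support, (CentreBlowup.step p Finset.univ la 0 B).r ≤ e :=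
    forall_le_step_gen B hdivB la rfl
  -- straightness of the child, F3 ∀ p (i)(ii)
  have hrdegB : B.r.degree = 2 := by rw [hrB, map_add, Finsupp.degree_single, Finsupp.degree_single]
  obtain ⟨haB, hstraightB⟩ := ResCone.straight_readings_of_resForm_prime hoB hrdegB hformB
  have htsch := tsch_row_of_exact_prime hlm hlf hmf (d := d) hrB hledB
  obtain ⟨hstraight', ha', -⟩ := ResCone.cInf_legal_readings_of_corner_prime p hdp hd2 hlm hlf hmf hrB hdivB hoB
    (by rw [haB]; exact ha) hstraightB htsch hoBp he3Bp
  have hr' : (CentreBlowup.step p Finset.univ la 0 B).r = B.r := by rw [hrBp, hrB]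
  have hform' : ResCone.resForm (CentreBlowup.step p Finset.univ la 0 B) = C a * X f ^ d := by
    refine resForm_eq_of_readings_prime hoBp (by rw [hr', hrdegB]) ?_ ?_
    · rw [hr', ha', haB]
    · intro m hm hne; rw [hr']; exact hstraight' m hm hne
  -- ledger, row and flag transport
  have hi1 : ∀ e ∈ B.F.support, 1 ≤ e mu := by
    intro e he
    have h := hdivB e he mu
    rw [hrB, Finsupp.add_apply, Finsupp.single_eq_of_ne hlm.symm, Finsupp.single_eq_same] at h
    simpa using h
  have hpdeg : ∀ e ∈ B.F.support, p ≤ e.degree := fun e he => by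
    have := Literature.Barriers.ResolutionOfSingularities.ordZero_le_of_coeff_ne_zero _ _
      (MvPolynomial.mem_support_iff.mp he)
    rw [hoB] at this
    have h6 : d + 2 ≤ e.degree := by exact_mod_cast this
    omega
  have hstraight6 : ∀ e ∈ B.F.support, e.degree = d + 2 → e f = d := by
    intro e he hdeg
    have hle := hdivB e he
    have hd' : e = B.r + (e - B.r) := (add_tsub_cancel_of_le hle).symm
    have hmdeg : (e - B.r).degree = d := by
      have := congrArg Finsupp.degree hd'; rw [map_add, hrdegB] at this; omega
    by_cases hm : e - B.r = Finsupp.single f d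
    · have := DFunLike.congr_fun hd' f
      rw [Finsupp.add_apply, hm, Finsupp.single_eq_same, hrB, Finsupp.add_apply, Finsupp.single_eq_of_ne hlf.symm,
        Finsupp.single_eq_of_ne hmf.symm] at this
      omega
    · exfalso
      have h0 := hstraightB (e - B.r) hmdeg hm
      rw [← hd'] at h0
      exact (mem_support_iff.mp he) h0
  have h7 := degree_succ_le_of_exact_prime hlm hlu hlf hmu hmf huf hoB hrB hstraight6 hledB
  have hled' : ∀ e ∈ (CentreBlowup.step p Finset.univ la 0 B).F.support, e f ≤ d - 1 → 2 ≤ e la ∧ 2 ≤ e mu :=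
    ResCone.ledger_step_zero_prime hlm hlf p hdp B h7 hledB
  have hrow' : ∀ e ∈ (CentreBlowup.step p Finset.univ la 0 B).F.support, e.degree < N - d → ¬ (e u = eu ∧ e f = ef) :=
    ResCone.row_step_zero_prime hlm hlu hlf hmu hmf huf p hdp B hi1 hpdeg hrowB
  have hV' := coeff_rowFlag_step_zero_prime p hdp hd2 hef hlm hlu hlf hmu hmf huf (Or.inl rfl) hrB hoB
  refine ⟨hrBp, hdivBp, ⟨a, ha, hform'⟩, hled', hrow', ?_⟩
  rw [hr', hV']
  exact hVB

end SwapTransport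

end Summit.ResolutionOfSingularities.ResolutionOfSingularities.Theorems.PIDim4

end
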